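import Mathlib
import Literature.Analysis.FluidPDE.Tao2016AveragedNS.ShiftSetCascadeFlows
import Summits.NavierStokesRegularity.NavierStokesRegularity.Theorems.TaoLadderRungTwoFlatMirrorTableDefs
import Summits.NavierStokesRegularity.NavierStokesRegularity.Theorems.TaoLadderRungTwoFlatMirrorReversibility
import Summits.NavierStokesRegularity.NavierStokesRegularity.Theorems.TaoLadderRungTwoFlatQuadPolarOn
import Summits.NavierStokesRegularity.NavierStokesRegularity.Theorems.TaoLadderRungTwoFlatFlowSymmetriesOn
import Summits.NavierStokesRegularity.NavierStokesRegularity.Theorems.TaoLadderRungTwoFlatPulseDefs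
import HarnessLib

/-!
# Pulses of the homogeneous mirror lattice: residue-freeness from `R`-symmetry and invariance of the λ₀ = 1
  layer under the scaling symmetry (helper for item stmt-NavierStokesRegularity-22987 `FlatGapCertificatesV2`,
  crux K_A♭ of route TaoLadderRungTwoFlat; cell harvest/h2-tao-ladder, p1 g19)

Three consistency facts about the typed λ₀ = 1 layer (`…Theorems.MirrorPulse`):

* `tendsto_atTop_of_isRSymmetricTraj` — an `R`-symmetric trajectory that is vacuum in the far PAST at every site
  is vacuum in the far FUTURE at every site: a symmetric pulse leaves NO residue (theory-1 g34's
  `tendsto_atTop_of_symmetric`, ported over the tree's `reflectFam`; pure filter logic);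
* `isGlobalSol_scale`, `isPulse_scale` — the scaling symmetry `κΦ(κ·)` (`κ > 0`) maps global solutions to global
  solutions and pulses of period `τ` to pulses of period `τ/κ` (the cell's invariant `a_peak·T_hop`);
* `linearisedHopContraction_scale` — (S2) is a property of the pulse ORBIT under scaling: if `Φ` has the
  linearised hop contraction with period `τ`, so does `κΦ(κ·)` with period `τ/κ` (same gauge, `ρ`, `N`; `C ↦ C/κ² + C/κ`), via
  the reparametrisation `u ↦ u(κ·)` of variational solutions (`isVariationalOn_scale`).

HONEST FRAMING: elementary calculus/logic about a MODEL lattice (Tao 2016 §4 vocabulary, shift set `S♭`, table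
`mirrorTable ε ε`); no pulse is constructed, nothing is certified, nothing is a statement about the Navier–Stokes
equations.
-/

noncomputable section

-- the sub-problem namespace repeats the summit name by design (D-0017)
set_option linter.dupNamespace false

namespace Summit.NavierStokesRegularity.NavierStokesRegularity.Theorems

open Set Filter Literature.Analysis.FluidPDE Literature.Analysis.FluidPDE.TaoCascade
open scoped Topology

namespace MirrorPulse

/-! ### Residue-freeness from symmetry -/

/-- **Zero residue from symmetry** (theory-1 g34, ported): an `R`-symmetric trajectory that tends to vacuum as
`t → −∞` at every site tends to vacuum as `t → +∞` at every site — what a symmetric pulse takes from the vacuum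
ahead it returns behind. [cite: Tao2016AveragedNS, §4 (4.1) (indexing); route TaoLadderRungTwoFlat, λ₀ = 1 layer] -/
theorem tendsto_atTop_of_isRSymmetricTraj {Φ : Fin 2 → ℤ → ℝ → ℝ} (hΦ : IsRSymmetricTraj Φ)
    (hpast : ∀ (i : Fin 2) (n : ℤ), Tendsto (Φ i n) atBot (𝓝 0)) (i : Fin 2) (n : ℤ) :
    Tendsto (Φ i n) atTop (𝓝 0) := by
  have h : Φ i n = fun t => Φ i (MirrorReversibility.reflIdx i n) (-t) := by
    funext t
    have := hΦ i n t
    simp only [MirrorReversibility.reflectFam] at this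
    exact this.symm
  rw [h]
  exact (hpast i _).comp tendsto_neg_atTop_atBot

/-! ### The scaling symmetry on global solutions and pulses -/

/-- The scaling symmetry preserves exact global solutions: `t ↦ κΦ(κt)` solves the homogeneous mirror lattice.
[cite: Tao2016AveragedNS, §4 (4.8) (homogeneity); route TaoLadderRungTwoFlat, λ₀ = 1 layer] -/
theorem isGlobalSol_scale {ε : ℝ} {Φ : Fin 2 → ℤ → ℝ → ℝ} (hΦ : IsGlobalSol ε Φ) (κ : ℝ) :
    IsGlobalSol ε (FlowSymmetry.scaleFam κ Φ) := by
  intro i n t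
  have h1 : HasDerivAt (fun s => Φ i n (κ * s)) (quadTermOn shiftSetFlat 0 (mirrorTable ε ε) Φ i n (κ * t) * κ) t := by
    have hg : HasDerivAt (fun s : ℝ => κ * s) κ t := by simpa using (hasDerivAt_id t).const_mul κ
    exact (hΦ i n (κ * t)).comp t hg
  have h2 := h1.const_mul κ
  have e : quadTermOn shiftSetFlat 0 (mirrorTable ε ε) (FlowSymmetry.scaleFam κ Φ) i n t =
      κ ^ 2 * quadTermOn shiftSetFlat 0 (mirrorTable ε ε) Φ i n (κ * t) :=
    FlowSymmetry.quadTermOn_scale_time shiftSetFlat 0 (mirrorTable ε ε) κ Φ (fun s => κ * s) i n t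
  show HasDerivAt (fun s => κ * Φ i n (κ * s)) _ t
  rw [e]
  exact h2.congr_deriv (by ring)

/-- The scaling symmetry maps shift-periodic families of period `τ` to period `τ/κ` (`κ ≠ 0`).
[cite: Tao2016AveragedNS, §5–§6 (self-similar ansatz); route TaoLadderRungTwoFlat, λ₀ = 1 layer] -/
theorem isShiftPeriodic_scale {τ : ℝ} {Φ : Fin 2 → ℤ → ℝ → ℝ} (hΦ : IsShiftPeriodic τ Φ) {κ : ℝ}
    (hκ : κ ≠ 0) : IsShiftPeriodic (τ / κ) (FlowSymmetry.scaleFam κ Φ) := by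
  intro i n t
  simp only [FlowSymmetry.scaleFam]
  rw [mul_add, mul_div_cancel₀ _ hκ, hΦ]

/-- **Pulses form a scaling family**: `κΦ(κ·)` is a pulse of period `τ/κ` for every `κ > 0`.
[cite: Tao2016AveragedNS, §5–§6 (self-similar ansatz); route TaoLadderRungTwoFlat, λ₀ = 1 layer] -/
theorem isPulse_scale {ε τ : ℝ} {Φ : Fin 2 → ℤ → ℝ → ℝ} (hΦ : IsPulse ε τ Φ) {κ : ℝ} (hκ : 0 < κ) :
    IsPulse ε (τ / κ) (FlowSymmetry.scaleFam κ Φ) := by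
  obtain ⟨hτ, hsol, hper, ⟨M, hM⟩, hne⟩ := hΦ
  refine ⟨div_pos hτ hκ, isGlobalSol_scale hsol κ, isShiftPeriodic_scale hper hκ.ne', ⟨κ * M, ?_⟩, ?_⟩
  · intro i n t
    simp only [FlowSymmetry.scaleFam, abs_mul, abs_of_pos hκ]
    exact mul_le_mul_of_nonneg_left (hM i n (κ * t)) hκ.le
  · simpa [FlowSymmetry.scaleFam, hκ.ne'] using hne

/-! ### (S2) is scale invariant -/

/-- Reparametrising a variational solution: if `u` solves the linearised equation along `Φ`, then `t ↦ u(κt)`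
(scaled by `κ`) solves it along `κΦ(κ·)`, with the bound transported from `[0, κT']` to `[0, T']`.
[cite: Tao2016AveragedNS, §4 (4.8); route TaoLadderRungTwoFlat, λ₀ = 1 layer] -/
theorem isVariationalOn_scale {ε T : ℝ} {Φ u : Fin 2 → ℤ → ℝ → ℝ} {κ : ℝ} (hκ : 0 < κ)
    (hu : IsVariationalOn ε (κ * T) Φ u) :
    IsVariationalOn ε T (FlowSymmetry.scaleFam κ Φ) (fun i n t => u i n (κ * t)) := by
  obtain ⟨hder, M, hM⟩ := hu
  refine ⟨fun i n t => ?_, M, fun i n t ht => hM i n (κ * t) ⟨by nlinarith [ht.1], by nlinarith [ht.2]⟩⟩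
  have hg : HasDerivAt (fun s : ℝ => κ * s) κ t := by simpa using (hasDerivAt_id t).const_mul κ
  have h1 := (hder i n (κ * t)).comp t hg
  -- Lin_{κΦ(κ·)}(u(κ·))(t) = κ · Lin_Φ(u)(κt)
  have e : QuadPolar.linTermOn shiftSetFlat 0 (mirrorTable ε ε) (FlowSymmetry.scaleFam κ Φ)
        (fun j k s => u j k (κ * s)) i n t =
      κ * QuadPolar.linTermOn shiftSetFlat 0 (mirrorTable ε ε) Φ u i n (κ * t) := by
    simp only [QuadPolar.linTermOn, QuadPolar.bilinOn, FlowSymmetry.scaleFam, Finset.mul_sum, mul_add]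
    congr 1 <;>
      (refine Finset.sum_congr rfl fun _ _ => Finset.sum_congr rfl fun _ _ => Finset.sum_congr rfl fun _ _ => ?_
       ring)
  rw [e]
  exact h1.congr_deriv (by ring)

/-- Converse reparametrisation (with `κ⁻¹`): a variational solution along `κΦ(κ·)` comes from one along `Φ`.
[cite: Tao2016AveragedNS, §4 (4.8); route TaoLadderRungTwoFlat, λ₀ = 1 layer] -/
theorem isVariationalOn_unscale {ε T : ℝ} {Φ v : Fin 2 → ℤ → ℝ → ℝ} {κ : ℝ} (hκ : 0 < κ)
    (hv : IsVariationalOn ε T (FlowSymmetry.scaleFam κ Φ) v) :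
    IsVariationalOn ε (κ * T) Φ (fun i n t => v i n (κ⁻¹ * t)) := by
  have hΦ : FlowSymmetry.scaleFam κ⁻¹ (FlowSymmetry.scaleFam κ Φ) = fun i n t => κ⁻¹ * (κ * Φ i n t) := by
    funext i n t
    simp only [FlowSymmetry.scaleFam]
    rw [← mul_assoc κ, mul_inv_cancel₀ hκ.ne', one_mul]
  have hT : κ⁻¹ * (κ * T) = T := by rw [← mul_assoc, inv_mul_cancel₀ hκ.ne', one_mul]
  have h := isVariationalOn_scale (T := κ * T) (inv_pos.mpr hκ) (hT.symm ▸ hv)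
  rw [hΦ] at h
  obtain ⟨hder, M, hM⟩ := h
  refine ⟨fun i n t => ?_, M, hM⟩
  have h1 := hder i n t
  have e : QuadPolar.linTermOn shiftSetFlat 0 (mirrorTable ε ε) (fun i n t => κ⁻¹ * (κ * Φ i n t))
        (fun j k s => v j k (κ⁻¹ * s)) i n t =
      QuadPolar.linTermOn shiftSetFlat 0 (mirrorTable ε ε) Φ (fun j k s => v j k (κ⁻¹ * s)) i n t := by
    simp only [QuadPolar.linTermOn, QuadPolar.bilinOn]
    congr 1 <;>
      (refine Finset.sum_congr rfl fun _ _ => Finset.sum_congr rfl fun _ _ => Finset.sum_congr rfl fun _ _ => ?_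
       rw [← mul_assoc κ⁻¹, inv_mul_cancel₀ hκ.ne', one_mul])
  rw [e] at h1
  exact h1

/-- **(S2) IS SCALE INVARIANT**: the linearised hop contraction of a family `Φ` with period `τ` implies that of
`κΦ(κ·)` with period `τ/κ`, with the same gauge, contraction factor and hop count (projection bound `C/κ² + C/κ`).
[cite: Tao2016AveragedNS, §6.3–6.4 (statement shape); route TaoLadderRungTwoFlat, λ₀ = 1 layer (S2)] -/
theorem linearisedHopContraction_scale {ε τ : ℝ} {Φ : Fin 2 → ℤ → ℝ → ℝ}
    (h : LinearisedHopContraction ε τ Φ) {κ : ℝ} (hκ : 0 < κ) :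
    LinearisedHopContraction ε (τ / κ) (FlowSymmetry.scaleFam κ Φ) := by
  obtain ⟨ω, ρ, C, N, hω, hρ0, hρ1, hC, hN, hcon⟩ := h
  refine ⟨ω, ρ, C / κ ^ 2 + C / κ, N, hω, hρ0, hρ1, by positivity, hN, fun v B hv hB => ?_⟩
  have hB0 : 0 ≤ B := le_trans (mul_nonneg (hω 0 0).le (abs_nonneg _)) (hB 0 0)
  -- pull `v` back to a variational solution `u = v(κ⁻¹ ·)` along `Φ` on `[0, Nτ]`
  have hT : κ * (N * (τ / κ)) = N * τ := by field_simp
  have hu := isVariationalOn_unscale hκ hv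
  rw [hT] at hu
  have hB' : ∀ i k, ω i k * |(fun i n t => v i n (κ⁻¹ * t)) i k 0| ≤ B := fun i k => by simpa using hB i k
  obtain ⟨c₁, c₂, hc₁, hc₂, hmain⟩ := hcon _ B hu hB'
  have hk2 : 0 < κ ^ 2 := pow_pos hκ 2
  refine ⟨c₁ / κ ^ 2, c₂ / κ, ?_, ?_, fun i k => ?_⟩
  · rw [abs_div, abs_of_pos hk2, add_mul]
    have : |c₁| / κ ^ 2 ≤ C * B / κ ^ 2 := div_le_div_of_nonneg_right hc₁ hk2.le
    have h2 : 0 ≤ C / κ * B := by positivity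
    calc |c₁| / κ ^ 2 ≤ C * B / κ ^ 2 := this
      _ = C / κ ^ 2 * B := by ring
      _ ≤ C / κ ^ 2 * B + C / κ * B := by linarith
  · rw [abs_div, abs_of_pos hκ, add_mul]
    have : |c₂| / κ ≤ C * B / κ := div_le_div_of_nonneg_right hc₂ hκ.le
    have h2 : 0 ≤ C / κ ^ 2 * B := by positivity
    calc |c₂| / κ ≤ C * B / κ := this
      _ = C / κ * B := by ring
      _ ≤ C / κ ^ 2 * B + C / κ * B := by linarith
  · have hm := hmain i k
    have eQ : quadTermOn shiftSetFlat 0 (mirrorTable ε ε) (FlowSymmetry.scaleFam κ Φ) i (k + N) (N * (τ / κ)) =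
        κ ^ 2 * quadTermOn shiftSetFlat 0 (mirrorTable ε ε) Φ i (k + N) (N * τ) := by
      rw [← hT]
      exact FlowSymmetry.quadTermOn_scale_time shiftSetFlat 0 (mirrorTable ε ε) κ Φ (fun s => κ * s) i (k + N)
        (N * (τ / κ))
    have eΦ : FlowSymmetry.scaleFam κ Φ i (k + N) (N * (τ / κ)) = κ * Φ i (k + N) (N * τ) := by
      simp only [FlowSymmetry.scaleFam]; rw [hT]
    have ev : v i (k + N) (N * (τ / κ)) = (fun i n t => v i n (κ⁻¹ * t)) i (k + N) (N * τ) := by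
      simp only
      congr 1
      field_simp
    rw [eQ, eΦ, ev]
    have e2 : (fun i n t => v i n (κ⁻¹ * t)) i (k + N) (N * τ) -
          c₁ / κ ^ 2 * (κ ^ 2 * quadTermOn shiftSetFlat 0 (mirrorTable ε ε) Φ i (k + N) (N * τ)) -
          c₂ / κ * (κ * Φ i (k + N) (N * τ)) =
        (fun i n t => v i n (κ⁻¹ * t)) i (k + N) (N * τ) -
          c₁ * quadTermOn shiftSetFlat 0 (mirrorTable ε ε) Φ i (k + N) (N * τ) - c₂ * Φ i (k + N) (N * τ) := by
      field_simp
    rw [e2]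
    exact hm

end MirrorPulse

end Summit.NavierStokesRegularity.NavierStokesRegularity.Theorems

end
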